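import Summits.Ventures.HSemireg.WedgeHankelRecurrenceGaussDiscreteOrthogonality

/-!
# Venture HSemireg — **AKHIEZER'S MAXIMAL-MASS THEOREM**: among ALL positive discrete measures `ν′` having the same moments as `ν` up to order `2n + 2`, the largest possible mass at a real
# point `ξ` is exactly the Christoffel function `λ_{n+1}(ξ) = 1 ∕ K_{n+1}(ξ, ξ)` (`K_{n+1}(ξ, ξ) = Σ_{j≤n+1} q_j(ξ)² ∕ h_j`): every such `ν′` has `ν′{ξ} ≤ λ_{n+1}(ξ)`, and the rule through `ξ`
# (N295 ∕ N296) is, for `q_{n+1}(ξ) ≠ 0`, such a measure carrying exactly that mass at `ξ` — an `IsGreatest` statement; the upper bound holds at every real `ξ`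

HONEST FRAMING. Part of the Lean index of the computation cell `pub-hsemireg` (seat p10 gen 43, Sunday typer «UNIFORM-IN-n»).  Real polynomials and finite sums only; no variety, no cohomology
theory, no sheaf, no Ext group and no semiregularity map is constructed here; nothing here says that HC / HC_CM / HC_AV holds; no Literature fact (unproved `Prop`) is declared or used.  Custodian
versions as in `WedgeHankelSiegelIdeal` (1/3).
SOURCES (cited).  N. I. Akhiezer, *The Classical Moment Problem* (1965), Thm 2.5.2–2.5.3 (the maximal mass `ρ_n(ξ)` concentrated at a point by a solution of the truncated moment problem equals
`1 ∕ Σ |P_k(ξ)|²`); M. G. Krein, A. A. Nudel'man, *The Markov Moment Problem*, Ch. III §3; P. L. Chebyshev (1874), A. A. Markov (1884), T. J. Stieltjes (1894); G. Szegő, *Orthogonal Polynomials*,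
Thm 3.1.3 and §3.411; G. Freud, *Orthogonal Polynomials*, §II.3.
PROOF TYPED HERE.  N297 `exists_rule_through_forall` gives, for every real `ξ`, a positive rule `(λ, x)` exact for `ν` in degree `≤ 2t` (`t ∈ {n, n+1}`) with `x_i = ξ` and `λ_i K_{n+1}(ξ, ξ) = 1`;
it is exact for every `ν′` with the same moments, so N271 `cms_atom_le_weight` bounds `ν′{ξ} ≤ λ_i`; for `q_{n+1}(ξ) ≠ 0` the quasi-Gauss rule through `ξ` (exact in degree `≤ 2n + 2`, N296
`quasi_gauss_weight_at_eq_christoffel`), read as a measure, attains the bound.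
DEDUP DISCLOSURE (`rg -n 'isGreatest_mass|max_mass|maximal_mass' Summits Literature`, 2026-09-03): N296 `atom_mass_mul_kernel_le_one` is the bound for the measure `ν` itself (via Cauchy–Schwarz);
here for every measure with the same moments, with attainment.  The 3 names below: 0 hits tree-wide.

WHAT IS IN THE TREE.  N271 `cms_atom_le_weight`; N296 `kernelPoly_eval_self_eq`, `kernelPoly_eval_self_pos`, `quasi_gauss_weight_at_eq_christoffel`; N297 `exists_rule_through_forall`; Mathlib `Finset.sum_filter`, `Finset.sum_ite_eq'`.
THIS FILE (namespace `Summit.Ventures.HSemireg.Wedge.HankelOuter` continued; CHAINED on N308 (import), N271, N296, N297; 0 definitions):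
* §1074 `rule_atom_mass_eq_weight` (a rule with distinct nodes, read as a measure, has mass `λ_i` at `x_i`), **`atom_mass_le_christoffel_of_moments_eq`** (every `ν′ ≥ 0` with the moments of `ν` up to
  order `2n + 2` has `ν′{ξ} · K_{n+1}(ξ, ξ) ≤ 1`, EVERY real `ξ`), **`isGreatest_atom_mass_christoffel`** (AKHIEZER: for `q_{n+1}(ξ) ≠ 0`, `1 ∕ K_{n+1}(ξ, ξ)` is the greatest mass at `ξ` over all
  such measures — attained by the quasi-Gauss rule through `ξ`).
CAVEATS.  Measures are positive and discrete with finitely many atoms (the class over which the maximum is taken is `{(N′, ν′ ≥ 0, w′)}` with matching moments); `ν` itself has `N > n + 2` atoms.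
At a zero `z_k` of `q_{n+1}` the bound `λ_k = 1 ∕ K_n(z_k, z_k)` is only a supremum under moments of order `2n + 2` (the natural candidate, the Gauss rule, has a positive defect in degree `2n + 2`,
N266) — that negative statement is not typed here.  Nothing Ext-side.  New names only.
-/

open Module Polynomial
open scoped Matrix Polynomial

namespace Summit.Ventures.HSemireg.Wedge.HankelOuter

/-! ## §1074. The maximal mass at a point under prescribed moments -/

/-- **A rule with distinct nodes, read as a measure, has mass `λ_i` at its node `x_i`.** [mechanism; this file, §1074] -/
theorem rule_atom_mass_eq_weight {t : ℕ} {μ x : Fin (t + 1) → ℝ} (hx : Function.Injective x) (i : Fin (t + 1)) :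
    ∑ j ∈ Finset.univ.filter (fun j => x j = x i), μ j = μ i := by
  have hset : Finset.univ.filter (fun j => x j = x i) = {i} := by
    ext j
    simp only [Finset.mem_filter, Finset.mem_univ, true_and, Finset.mem_singleton]
    exact ⟨fun h => hx h, fun h => by rw [h]⟩
  rw [hset, Finset.sum_singleton]

/-- **Every measure with the same moments has mass `≤ λ_{n+1}(ξ)` at `ξ`.**  Let `ν_l > 0` on `N` distinct nodes, `n + 2 < N`, with orthogonal polynomials `q_0, …, q_{n+2}`; let `ν′ ≥ 0` on nodes
`w′` (any number) have the same moments as `ν` up to order `2n + 2`.  Then for every real `ξ`: `ν′{ξ} · Σ_{j≤n+1} q_j(ξ)² ∕ h_j ≤ 1`. [Akhiezer Thm 2.5.3; Krein–Nudel'man III §3; this file, §1074] -/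
theorem atom_mass_le_christoffel_of_moments_eq {N N' n : ℕ} {ν w : Fin N → ℝ} (hν : ∀ l, 0 < ν l) (hw : Function.Injective w) (hnN : n + 2 < N) {q : ℕ → ℝ[X]} (hq0 : q 0 = 1)
    (hmonic : ∀ k, k ≤ n + 2 → (q k).Monic) (hdeg : ∀ k, k ≤ n + 2 → (q k).natDegree = k)
    (horth : ∀ k, k ≤ n + 2 → ∀ G : ℝ[X], G.natDegree < k → ∑ l, ν l * (q k * G).eval (w l) = 0) {ν' w' : Fin N' → ℝ} (hν' : ∀ l, 0 ≤ ν' l)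
    (hmom' : ∀ p, p ≤ 2 * n + 2 → ∑ l, ν' l * w' l ^ p = ∑ l, ν l * w l ^ p) (ξ : ℝ) :
    (∑ l ∈ Finset.univ.filter (fun l => w' l = ξ), ν' l) * ∑ j ∈ Finset.range (n + 2), ((q j).eval ξ) ^ 2 / ∑ l, ν l * ((q j).eval (w l)) ^ 2 ≤ 1 := by
  obtain ⟨t, μ, x, i, -, ht, hx, hxi, -, hmom, hker⟩ := exists_rule_through_forall hν hw hnN hq0 hmonic hdeg horth ξ
  have hmomν' : ∀ p, p ≤ 2 * t → ∑ j, μ j * x j ^ p = ∑ l, ν' l * w' l ^ p := fun p hp => by rw [hmom p hp, hmom' p (by omega)]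
  have hatom := cms_atom_le_weight hx hν' hmomν' i
  rw [hxi] at hatom
  have hKpos : 0 < ∑ j ∈ Finset.range (n + 2), ((q j).eval ξ) ^ 2 / ∑ l, ν l * ((q j).eval (w l)) ^ 2 := by
    rw [← kernelPoly_eval_self_eq]
    exact kernelPoly_eval_self_pos hν hw (by omega) hq0 (fun k hk => hmonic k (by omega)) (fun k hk => hdeg k (by omega)) ξ
  calc (∑ l ∈ Finset.univ.filter (fun l => w' l = ξ), ν' l) * ∑ j ∈ Finset.range (n + 2), ((q j).eval ξ) ^ 2 / ∑ l, ν l * ((q j).eval (w l)) ^ 2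
      ≤ μ i * ∑ j ∈ Finset.range (n + 2), ((q j).eval ξ) ^ 2 / ∑ l, ν l * ((q j).eval (w l)) ^ 2 := mul_le_mul_of_nonneg_right hatom hKpos.le
    _ = 1 := hker

/-- **AKHIEZER'S MAXIMAL-MASS THEOREM.**  Let `ν_l > 0` on `N` distinct nodes `w_l`, `n + 2 < N`, with orthogonal polynomials `q_0, …, q_{n+2}` and `h_j = Σ_l ν_l q_j(w_l)²`, and let `ξ` be real
with `q_{n+1}(ξ) ≠ 0`.  Then `1 ∕ Σ_{j≤n+1} q_j(ξ)² ∕ h_j` is the GREATEST value of `ν′{ξ}` over all positive discrete measures `ν′` (any finite number of atoms) whose moments agree with those of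
`ν` up to order `2n + 2`.
[Akhiezer Thm 2.5.2–2.5.3; Krein–Nudel'man III §3; Szegő Thm 3.1.3; this file, §1074] -/
theorem isGreatest_atom_mass_christoffel {N n : ℕ} {ν w : Fin N → ℝ} (hν : ∀ l, 0 < ν l) (hw : Function.Injective w) (hnN : n + 2 < N) {q : ℕ → ℝ[X]} (hq0 : q 0 = 1)
    (hmonic : ∀ k, k ≤ n + 2 → (q k).Monic) (hdeg : ∀ k, k ≤ n + 2 → (q k).natDegree = k)
    (horth : ∀ k, k ≤ n + 2 → ∀ G : ℝ[X], G.natDegree < k → ∑ l, ν l * (q k * G).eval (w l) = 0) {ξ : ℝ} (hξ : (q (n + 1)).eval ξ ≠ 0) :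
    IsGreatest {m : ℝ | ∃ (N' : ℕ) (ν' w' : Fin N' → ℝ), (∀ l, 0 ≤ ν' l) ∧ (∀ p, p ≤ 2 * n + 2 → ∑ l, ν' l * w' l ^ p = ∑ l, ν l * w l ^ p) ∧
        m = ∑ l ∈ Finset.univ.filter (fun l => w' l = ξ), ν' l}
      (1 / ∑ j ∈ Finset.range (n + 2), ((q j).eval ξ) ^ 2 / ∑ l, ν l * ((q j).eval (w l)) ^ 2) := by
  have hKpos : 0 < ∑ j ∈ Finset.range (n + 2), ((q j).eval ξ) ^ 2 / ∑ l, ν l * ((q j).eval (w l)) ^ 2 := by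
    rw [← kernelPoly_eval_self_eq]
    exact kernelPoly_eval_self_pos hν hw (by omega) hq0 (fun k hk => hmonic k (by omega)) (fun k hk => hdeg k (by omega)) ξ
  constructor
  · -- attained by the quasi-Gauss rule through `ξ` (N295 ∕ N296), exact in degree `≤ 2n + 2`
    obtain ⟨y, μ, i, hy, hyi, hpos, hmom, hker, -⟩ := quasi_gauss_weight_at_eq_christoffel hν hw hnN hq0 hmonic hdeg horth hξ
    refine ⟨n + 2, μ, y, fun j => (hpos j).le, hmom, ?_⟩
    have hmass : ∑ j ∈ Finset.univ.filter (fun j => y j = ξ), μ j = μ i := by rw [← hyi]; exact rule_atom_mass_eq_weight hy.injective i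
    rw [hmass, eq_comm, eq_div_iff hKpos.ne']
    exact hker
  · rintro m ⟨N', ν', w', hν', hmom', rfl⟩
    rw [le_div_iff₀ hKpos]
    exact atom_mass_le_christoffel_of_moments_eq hν hw hnN hq0 hmonic hdeg horth hν' hmom' ξ

end Summit.Ventures.HSemireg.Wedge.HankelOuter
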